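import Summits.AtomisticToContinuum.HydrodynamicLimit.Theorems.SpeedCapSurgeryCappedEulerLimit
import HarnessLib

/-!
# Route `SpeedCapSurgery`, crux `CappedEulerLimit` (stmt-AtomisticToContinuum-17739), IV: the crux from the MESOSCOPIC capped window step

Line `registered`, lead cycle 2 (continuation seat prover-line-stmt-AtomisticToContinuum-17739-c1-0): RESHAPE of the research
residue. The registered stub of cycle 1, `∃ ηw > 0, CappedWindowEntropyStepBelow ηw` (part I, §3), asks the capped window inequality
`H_N(s+w') ≤ (1 + K√log(N+2)·w')·H_N(s) + w'·(N+1)^{1-a}` for ALL sub-windows `0 < w' ≤ w_N`, i.e. (letting `w' → 0`) an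
INSTANTANEOUS entropy-production bound `D⁺H_N ≤ K M_N H_N + (N+1)^{1-a}`. That is more than the Nachtergaele–Yau / Olla–Varadhan–Yau
mechanism delivers: the one-block replacement of the currents is a statement about TIME AVERAGES over mesoscopic windows
`w_N ≍ τ (N+1)^{-1/3}` (many mean free times; OVY 1993 §3, the kinetic window of the sub-problem's docks), and for shorter windows only
the static entropy inequality is available, whose error `O(√(N·H))` is not of the required form in the range
`(N+1)^{1-2a} ≲ H ≲ N/log N`. This file re-types the residue to exactly the literature step and re-proves the glue:

* §1 `CappedWindowEntropyStepMesoBelow ηw` — the same frame and the same inequality, asked only for windows of MESOSCOPIC length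
  `w_N ≤ w' ≤ 2 w_N`, with `w_N → 0` (the old statement implies the new one: `windowStepMeso_of_windowStep`);
* §2 `chain_window_gronwall` — discrete Gronwall along ONE chain of windows of length in `[w, 2w]` started at `0`
  (no control of `H` off the chain is needed, so no start-up / window-continuity clause enters);
* §3 `cappedEntropyPropagation_of_windowStepMeso`, `CappedEulerLimit_of_cappedWindowStepMeso` — the crux from the re-typed residue
  (conditional closure; the skeleton `Lines/registered.lean` v3 is this theorem applied to the single stub `stub_cappedWindowStepMeso`).

References: B. Nachtergaele, H.-T. Yau, Comm. Math. Phys. 243 (2003) §5 Lemma 5.1, §7.2; S. Olla, S. R. S. Varadhan, H.-T. Yau,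
Comm. Math. Phys. 155 (1993) §3; H.-T. Yau, Lett. Math. Phys. 22 (1991) §2. (`--supports stmt-AtomisticToContinuum-17739`.)
-/

noncomputable section

namespace Summit.AtomisticToContinuum.HydrodynamicLimit.Theorems.CappedEulerLimit

open scoped ENNReal NNReal Topology
open MeasureTheory Filter Set InformationTheory
open Literature.Analysis.FluidPDE
open Literature.MathematicalPhysics.KineticTheory
open Summit.AtomisticToContinuum.HydrodynamicLimit.Theses.SpeedCapSurgery
open Summit.AtomisticToContinuum.HydrodynamicLimit.Theorems.KineticWindowGronwallActivityInversion

/-! ## §1 The re-typed residue: the capped window entropy step on MESOSCOPIC windows -/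

/-- registered stub signature `stub_cappedWindowStepMeso` of line `registered`, crux `CappedEulerLimit`
(stmt-AtomisticToContinuum-17739) — route-internal, not a cited fact.
**The capped window entropy step with a polynomial one-block rate, on MESOSCOPIC windows, below the packing threshold `ηw`.**
Frame of `CappedEntropyPropagationBelow` (profiles, `σ < σ₀`, classical solution in the band `ρ_t σ³ < ηw`, flow family,
probability initial laws with the `t = 0` LLN, time-zero identity, concentrating thermodynamic reference family); for every
`t ∈ [0,T)` and every cap constant `C` there are `K ≥ 0`, a RATE `a > 0`, window lengths `w_N > 0` with `w_N → 0` and `N₀`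
such that for `N ≥ N₀` every window `[s, s + w'] ⊆ [0, t]` of MESOSCOPIC length `w_N ≤ w' ≤ 2 w_N` costs
`H_N(s + w') ≤ (1 + K·√log(N+2)·w')·H_N(s) + w'·(N+1)^{1-a}`,
`H_N(r) := (KL((Φ_N,r)_*(λ_N|cap_{t,C}) ‖ localGibbsLaw σ (thermoActivity σ (ρ r)) (u r) (θ r) N Φ_N)).toReal`.
This is Nachtergaele–Yau's inequality `H' ≤ δ⁻¹M(H + N·ω)` on the cap event (cut-off `M = C√log(N+2)` EXACT on the support;
constant linear in `M`, §5 Lemma 5.1) integrated over ONE MESOSCOPIC WINDOW (the prover chooses `w_N`, e.g. `τ(N+1)^{-1/3}`),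
the one-block error carrying a rate `ω_N ≤ N^{-a}`. Differs from `CappedWindowEntropyStepBelow` only in the window range
(`w_N ≤ w' ≤ 2w_N` instead of `0 < w' ≤ w_N`) and the clause `w_N → 0`. [cite: NachtergaeleYau2003, §5 Lemma 5.1 and §7.2]
[cite: OllaVaradhanYau1993, §3] -/
def CappedWindowEntropyStepMesoBelow (ηw : ℝ) : Prop :=
  ∀ (a₀ θ₀ : T3 → ℝ) (u₀ : T3 → V3), Continuous a₀ → Continuous θ₀ → Continuous u₀ →
    (∀ x, 0 < a₀ x) → (∀ x, 0 < θ₀ x) →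
    ∃ σ₀ : ℝ, 0 < σ₀ ∧ ∀ σ : ℝ, 0 < σ → σ < σ₀ →
      ∀ (T : ℝ) (ρ θ : ℝ → T3 → ℝ) (u : ℝ → T3 → V3), IsHardSphereEulerSolution σ T ρ u θ →
        (∀ t ∈ Ico 0 T, ∀ x, ρ t x * σ ^ 3 < ηw) →
        ∀ Φ : (N : ℕ) → HardSphereFlow (Torus.geometry (Fin 3)) (hsDiameter σ N) (N + 1),
          (∀ N, IsProbabilityMeasure (localGibbsLaw σ a₀ u₀ θ₀ N (Φ N))) →
          TendstoHydroFieldsAt (fun N => localGibbsLaw σ a₀ u₀ θ₀ N (Φ N)) Φ ρ u θ 0 →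
          (∀ N : ℕ, localGibbsLaw σ (thermoActivity σ (ρ 0)) (u 0) (θ 0) N (Φ N) =
            localGibbsLaw σ a₀ u₀ θ₀ N (Φ N)) →
          (∀ t ∈ Ico 0 T, RefConcentrates σ (ρ t) (θ t) (u t) Φ) →
          ∀ t ∈ Ico 0 T, ∀ C : ℝ, ∃ K a : ℝ, 0 ≤ K ∧ 0 < a ∧ ∃ w : ℕ → ℝ, (∀ N, 0 < w N) ∧
            Tendsto w atTop (𝓝 0) ∧
            ∃ N₀ : ℕ, ∀ N : ℕ, N₀ ≤ N → ∀ s w' : ℝ, 0 ≤ s → w N ≤ w' → w' ≤ 2 * w N → s + w' ≤ t →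
              (klDiv ((Φ N).lawAt (cappedLaw σ a₀ θ₀ u₀ t C N (Φ N)) (s + w'))
                  (localGibbsLaw σ (thermoActivity σ (ρ (s + w'))) (u (s + w')) (θ (s + w'))
                    N (Φ N))).toReal ≤
                (1 + K * Real.sqrt (Real.log ((N : ℝ) + 2)) * w') *
                    (klDiv ((Φ N).lawAt (cappedLaw σ a₀ θ₀ u₀ t C N (Φ N)) s)
                      (localGibbsLaw σ (thermoActivity σ (ρ s)) (u s) (θ s) N (Φ N))).toReal +
                  w' * ((N : ℝ) + 1) ^ (1 - a)

/-- **The cycle-1 residue implies the re-typed one**: a window step valid for all sub-windows `0 < w' ≤ w_N` is valid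
on the mesoscopic windows `w_N/2 ≤ w' ≤ w_N` of the halved scale `w_N/2` (and `min (w_N/2) (1/(N+1)) → 0` keeps positivity
and the limit clause). So the reshape only REMOVES demand from the stub. [folklore] -/
theorem windowStepMeso_of_windowStep {ηw : ℝ} (h : CappedWindowEntropyStepBelow ηw) :
    CappedWindowEntropyStepMesoBelow ηw := by
  intro a₀ θ₀ u₀ ha hθ hu ha0 hθ0
  obtain ⟨σ₀, hσ₀, H⟩ := h a₀ θ₀ u₀ ha hθ hu ha0 hθ0
  refine ⟨σ₀, hσ₀, fun σ hσ hσlt T ρ θ u hE hguard Φ hprob h0 hzero hfam t ht C => ?_⟩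
  obtain ⟨K, a, hK, ha', w, hw, N₀, hstep⟩ := H σ hσ hσlt T ρ θ u hE hguard Φ hprob h0 hzero hfam t ht C
  -- the halved, summable scale `w'_N := min (w_N / 2) (1 / (N + 2))`
  refine ⟨K, a, hK, ha', fun N => min (w N / 2) (1 / ((N : ℝ) + 2)), fun N => ?_, ?_, N₀, ?_⟩
  · exact lt_min (half_pos (hw N)) (by positivity)
  · have h1 : Tendsto (fun N : ℕ => 1 / ((N : ℝ) + 2)) atTop (𝓝 0) :=
      tendsto_const_nhds.div_atTop (tendsto_atTop_add_const_right _ 2 tendsto_natCast_atTop_atTop)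
    refine tendsto_of_tendsto_of_tendsto_of_le_of_le tendsto_const_nhds h1 (fun N => ?_) fun N => min_le_right _ _
    exact (lt_min (half_pos (hw N)) (by positivity)).le
  · intro N hN s w' hs hw1 hw2 hsw
    have hw'pos : 0 < w' := (lt_min (half_pos (hw N)) (by positivity)).trans_le hw1
    have hw'le : w' ≤ w N := by
      have : 2 * min (w N / 2) (1 / ((N : ℝ) + 2)) ≤ 2 * (w N / 2) :=
        mul_le_mul_of_nonneg_left (min_le_left _ _) zero_le_two
      linarith
    exact hstep N hN s w' hs hw'pos hw'le hsw

/-! ## §2 Real-analysis glue: Gronwall along a chain of mesoscopic windows -/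

/-- **Chain-window discrete Gronwall.** If `F ≥ 0` and every window `[s, s + w'] ⊆ [0, t]` of length `w ≤ w' ≤ 2w` costs
`F (s + w') ≤ (1 + A w') F s + w' b` (`A, b ≥ 0`), and `w ≤ t`, then `F t ≤ e^{A t} (F 0 + t b)`: with `K = ⌊t/w⌋ ≥ 1`,
iterate along the grid `k w`, `k ≤ K - 1` (`QuenchedCellClock.gronwall_iterate_le`, windows of length exactly `w`), close with
the last window from `(K-1) w` to `t`, of length `t − (K−1)w ∈ [w, 2w)`, and use `(1 + A w')(1 + A w)^{K-1} ≤ e^{A t}`. Only the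
values of `F` on this one chain enter. [folklore] -/
theorem chain_window_gronwall (F : ℝ → ℝ) {t A w b : ℝ} (hA : 0 ≤ A) (hw : 0 < w) (hwt : w ≤ t)
    (hb : 0 ≤ b) (hF0 : ∀ s, 0 ≤ F s)
    (hstep : ∀ s w' : ℝ, 0 ≤ s → w ≤ w' → w' ≤ 2 * w → s + w' ≤ t →
      F (s + w') ≤ (1 + A * w') * F s + w' * b) :
    F t ≤ Real.exp (A * t) * (F 0 + t * b) := by
  have ht : 0 ≤ t := hw.le.trans hwt
  have hK1 : 1 ≤ ⌊t / w⌋₊ := Nat.le_floor (by rw [Nat.cast_one, le_div_iff₀ hw, one_mul]; exact hwt)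
  -- `⌊t/w⌋ = K' + 1`
  set K' := ⌊t / w⌋₊ - 1 with hK'_def
  have hKK' : ⌊t / w⌋₊ = K' + 1 := by omega
  have hKle : ((K' : ℝ) + 1) * w ≤ t := by
    have : ((⌊t / w⌋₊ : ℕ) : ℝ) ≤ t / w := Nat.floor_le (div_nonneg ht hw.le)
    rw [hKK', le_div_iff₀ hw] at this
    push_cast at this
    exact this
  have hKlt : t < ((K' : ℝ) + 1) * w + w := by
    have : t / w < ((⌊t / w⌋₊ : ℕ) : ℝ) + 1 := Nat.lt_floor_add_one _
    rw [hKK', div_lt_iff₀ hw] at this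
    push_cast at this
    linarith
  -- the grid recursion up to `K'` (windows of length exactly `w`)
  have hrec : ∀ k, k < K' →
      F (((k + 1 : ℕ) : ℝ) * w) ≤ (1 + A * w) * F ((k : ℝ) * w) + w * b := by
    intro k hk
    have hs0 : 0 ≤ (k : ℝ) * w := by positivity
    have hs1 : (k : ℝ) * w + w ≤ t := by
      have hk1 : (k : ℝ) + 1 ≤ K' := by exact_mod_cast hk
      have h2 : ((k : ℝ) + 1) * w ≤ (K' : ℝ) * w := mul_le_mul_of_nonneg_right hk1 hw.le
      nlinarith
    have := hstep _ w hs0 le_rfl (by linarith) hs1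
    push_cast
    rw [add_mul, one_mul]
    exact this
  have hiter := QuenchedCellClock.gronwall_iterate_le (fun k => F ((k : ℝ) * w)) (a := A * w) (b := w * b)
    (by positivity) (by positivity) K' hrec K' le_rfl
  simp only [Nat.cast_zero, zero_mul] at hiter
  -- nonnegativity of the accumulated data and `K' w b ≤ t b`
  have hK'le : (K' : ℝ) * w ≤ t := by nlinarith
  have hdata0 : 0 ≤ F 0 + (K' : ℝ) * (w * b) := by have := hF0 0; positivity
  have hdata : F 0 + (K' : ℝ) * (w * b) ≤ F 0 + t * b := by
    have : (K' : ℝ) * w * b ≤ t * b := mul_le_mul_of_nonneg_right hK'le hb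
    nlinarith [this]
  -- the last window, of length `w' = t - K' w ∈ [w, 2w]`
  set w' := t - (K' : ℝ) * w with hw'_def
  have hw'1 : w ≤ w' := by rw [hw'_def]; linarith
  have hw'2 : w' ≤ 2 * w := by rw [hw'_def]; linarith
  have hw'0 : 0 ≤ w' := hw.le.trans hw'1
  have hlast := hstep ((K' : ℝ) * w) w' (by positivity) hw'1 hw'2 (by rw [hw'_def]; linarith)
  have ht' : (K' : ℝ) * w + w' = t := by rw [hw'_def]; ring
  rw [ht'] at hlast
  have hexp1 : (1 : ℝ) ≤ Real.exp (A * t) := Real.one_le_exp (by positivity)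
  -- `(1 + A w') (1 + A w)^K' ≤ e^{A t}`
  have hpow : (1 + A * w') * (1 + A * w) ^ K' ≤ Real.exp (A * t) := by
    have h1 : (1 + A * w) ^ K' ≤ Real.exp (A * w) ^ K' :=
      pow_le_pow_left₀ (by positivity) (by linarith [Real.add_one_le_exp (A * w)]) K'
    have h2 : 1 + A * w' ≤ Real.exp (A * w') := by linarith [Real.add_one_le_exp (A * w')]
    calc (1 + A * w') * (1 + A * w) ^ K' ≤ Real.exp (A * w') * Real.exp (A * w) ^ K' :=
          mul_le_mul h2 h1 (by positivity) (by positivity)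
      _ = Real.exp (A * w' + K' * (A * w)) := by rw [← Real.exp_nat_mul, ← Real.exp_add]
      _ = Real.exp (A * t) := by congr 1; rw [hw'_def]; ring
  have h1 : (1 + A * w') * F ((K' : ℝ) * w) ≤ Real.exp (A * t) * (F 0 + (K' : ℝ) * (w * b)) :=
    calc (1 + A * w') * F ((K' : ℝ) * w)
        ≤ (1 + A * w') * ((1 + A * w) ^ K' * (F 0 + (K' : ℝ) * (w * b))) :=
          mul_le_mul_of_nonneg_left hiter (by positivity)
      _ = ((1 + A * w') * (1 + A * w) ^ K') * (F 0 + (K' : ℝ) * (w * b)) := by ring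
      _ ≤ Real.exp (A * t) * (F 0 + (K' : ℝ) * (w * b)) := mul_le_mul_of_nonneg_right hpow hdata0
  have h2 : w' * b ≤ Real.exp (A * t) * (w' * b) := le_mul_of_one_le_left (by positivity) hexp1
  calc F t ≤ (1 + A * w') * F ((K' : ℝ) * w) + w' * b := hlast
    _ ≤ Real.exp (A * t) * (F 0 + (K' : ℝ) * (w * b)) + Real.exp (A * t) * (w' * b) := add_le_add h1 h2
    _ = Real.exp (A * t) * (F 0 + ((K' : ℝ) * w + w') * b) := by ring
    _ = Real.exp (A * t) * (F 0 + t * b) := by rw [ht']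

/-! ## §3 The crux from the mesoscopic capped window step -/

/-- **Capped relative-entropy propagation from the MESOSCOPIC capped window step.** As
`cappedEntropyPropagation_of_windowStep` (part I, §5) with the chain-window Gronwall (§2) in place of the flexible-window one:
`ηd := min η₁ ηw`, `σ₀ := min (1/2) σw`; for `t ∈ [0,T)`, `C` and eventually in `N` (`N ≥ N₀` and `w_N ≤ t` when `t > 0`, by
`w_N → 0`; at `t = 0` the bound is the time-zero bound), `F_N(t) ≤ e^{K√log(N+2) t}(F_N(0) + t (N+1)^{1-a})` with `F_N(0) ≤ 1`
(time-zero identity + `stub_cappedKlDivZero`), `KL_t = ofReal (F_N t)` (`stub_cappedKlDivNeTop`), and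
`e^{K t √log(N+2)}·(1 + t)(N+1)^{-min(a,1)} → 0` (`tendsto_exp_sqrt_log_mul_rpow_neg`). [cite: NachtergaeleYau2003, §7.2]
[cite: Yau1991, §2] -/
theorem cappedEntropyPropagation_of_windowStepMeso (hW : ∃ ηw : ℝ, 0 < ηw ∧ CappedWindowEntropyStepMesoBelow ηw) :
    ∃ ηd : ℝ, 0 < ηd ∧ CappedEntropyPropagationBelow ηd := by
  obtain ⟨r, hr, Rf, hsol, hbd, hcont, huniq, η₂, hη₂, -, hexp⟩ := insertionFactor_package
  obtain ⟨ηw, hηw, HW⟩ := hW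
  refine ⟨min (thresh r η₂) ηw, lt_min (thresh_pos hr hη₂) hηw, ?_⟩
  intro a₀ θ₀ u₀ ha hθ hu ha0 hθ0
  obtain ⟨σw, hσw, HWσ⟩ := HW a₀ θ₀ u₀ ha hθ hu ha0 hθ0
  refine ⟨min (1 / 2) σw, lt_min (by norm_num) hσw, ?_⟩
  intro σ hσ hσlt T ρ θ u hE hguard Φ hprob h0 hzero hfam t ht C
  have hσ2 : σ ≤ 1 / 2 := (hσlt.trans_le (min_le_left _ _)).le
  have hσw' : σ < σw := hσlt.trans_le (min_le_right _ _)
  have hg1 : ∀ s ∈ Ico 0 T, ∀ x, ρ s x * σ ^ 3 < thresh r η₂ :=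
    fun s hs x => (hguard s hs x).trans_le (min_le_left _ _)
  have hgw : ∀ s ∈ Ico 0 T, ∀ x, ρ s x * σ ^ 3 < ηw :=
    fun s hs x => (hguard s hs x).trans_le (min_le_right _ _)
  -- the mesoscopic window step at `(t, C)`
  obtain ⟨K, a, hK, ha', w, hw, hw0, N₀, hstep⟩ :=
    HWσ σ hσ hσw' T ρ θ u hE hgw Φ hprob h0 hzero hfam t ht C
  -- Yau's functional `F_N(r) = H_N(r)` (a real number; `0` if the divergence were infinite)
  set F : ℕ → ℝ → ℝ := fun N r =>
    (klDiv ((Φ N).lawAt (cappedLaw σ a₀ θ₀ u₀ t C N (Φ N)) r)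
      (localGibbsLaw σ (thermoActivity σ (ρ r)) (u r) (θ r) N (Φ N))).toReal with hF_def
  -- time zero: `F_N(0) ≤ 1` (time-zero identity + `stub_cappedKlDivZero`)
  have hF0 : ∀ N, F N 0 ≤ 1 := fun N => by
    simp only [hF_def, hzero N]
    refine ENNReal.toReal_le_of_le_ofReal zero_le_one ?_
    rw [ENNReal.ofReal_one]
    exact stub_cappedKlDivZero hσ2 ha hθ hu ha0 hθ0 N (Φ N) (capEvent σ t C N (Φ N))
  -- chain-window Gronwall, eventually in `N`
  have hGr : ∀ᶠ N : ℕ in atTop, F N t ≤ Real.exp (K * Real.sqrt (Real.log ((N : ℝ) + 2)) * t) *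
      (F N 0 + t * ((N : ℝ) + 1) ^ (1 - a)) := by
    rcases ht.1.eq_or_lt with ht0 | htpos
    · refine Eventually.of_forall fun N => ?_
      rw [← ht0, mul_zero, Real.exp_zero, one_mul, zero_mul, add_zero]
    · have hwt : ∀ᶠ N : ℕ in atTop, w N ≤ t := (hw0.eventually (Iic_mem_nhds htpos)).mono fun N hN => hN
      filter_upwards [hwt, eventually_ge_atTop N₀] with N hN hN₀
      exact chain_window_gronwall (F N) (by positivity) (hw N) hN (by positivity)
        (fun _ => ENNReal.toReal_nonneg) (fun s w' hs hw1 hw2 hsw => hstep N hN₀ s w' hs hw1 hw2 hsw)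
  -- finiteness at time `t` (`stub_cappedKlDivNeTop` at the thermodynamic reference, continuous and positive in the band)
  have hρtc : Continuous (ρ t) := (hE.smooth_density.isSmooth_slice ht).continuous
  have hutc : Continuous (u t) := (hE.smooth_velocity.isSmooth_slice ht).continuous
  have hθtc : Continuous (θ t) := (hE.smooth_temperature.isSmooth_slice ht).continuous
  have hρ1 : ∫ x, ρ t x = 1 :=
    PolynomialCompressionEverywhere.integral_density_eq_one hσ2 ha hθ hu ha0 hθ0 hE Φ h0 ht
  obtain ⟨-, -, hat, hat0, -⟩ := thermoActivity_spec hr hsol hbd hcont huniq hη₂ hexp hσ hρtc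
    (hE.density_pos t ht) hρ1 (fun x => (hg1 t ht x).le)
  have hfin : ∀ N, klDiv ((Φ N).lawAt (cappedLaw σ a₀ θ₀ u₀ t C N (Φ N)) t)
      (localGibbsLaw σ (thermoActivity σ (ρ t)) (u t) (θ t) N (Φ N)) ≠ ⊤ := fun N =>
    stub_cappedKlDivNeTop hσ hσ2 ha hθ hu ha0 hθ0 hat hθtc hutc hat0 (hE.temperature_pos t ht) N (Φ N)
      (capEvent σ t C N (Φ N)) t
  -- the comparison sequence `g_N → 0`
  set g : ℕ → ℝ := fun N => Real.exp (K * t * Real.sqrt (Real.log ((N : ℝ) + 2))) * ((N : ℝ) + 1) ^ (-(1 : ℝ)) +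
    t * (Real.exp (K * t * Real.sqrt (Real.log ((N : ℝ) + 2))) * ((N : ℝ) + 1) ^ (-a)) with hg_def
  have hg : Tendsto g atTop (𝓝 0) := by
    have h1 := tendsto_exp_sqrt_log_mul_rpow_neg (K := K * t) (a := 1) (mul_nonneg hK ht.1) one_pos
    have h2 := (tendsto_exp_sqrt_log_mul_rpow_neg (K := K * t) (a := a) (mul_nonneg hK ht.1) ha').const_mul t
    simpa [hg_def] using h1.add h2
  -- the real bound `F_N(t)/(N+1) ≤ g_N`, eventually
  have hbound : ∀ᶠ N : ℕ in atTop, F N t / ((N : ℝ) + 1) ≤ g N := by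
    filter_upwards [hGr] with N hGrN
    have hX : (0 : ℝ) < (N : ℝ) + 1 := by positivity
    have hE' : Real.exp (K * Real.sqrt (Real.log ((N : ℝ) + 2)) * t) =
        Real.exp (K * t * Real.sqrt (Real.log ((N : ℝ) + 2))) := by ring_nf
    have h1a : ((N : ℝ) + 1) ^ (1 - a) = ((N : ℝ) + 1) * ((N : ℝ) + 1) ^ (-a) := by
      rw [sub_eq_add_neg, Real.rpow_add hX, Real.rpow_one]
    have hm1 : ((N : ℝ) + 1) ^ (-(1 : ℝ)) = ((N : ℝ) + 1)⁻¹ := Real.rpow_neg_one _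
    have hle : F N t ≤ Real.exp (K * t * Real.sqrt (Real.log ((N : ℝ) + 2))) *
        (1 + t * (((N : ℝ) + 1) * ((N : ℝ) + 1) ^ (-a))) := by
      have := hGrN
      rw [hE', h1a] at this
      refine this.trans (mul_le_mul_of_nonneg_left ?_ (Real.exp_pos _).le)
      linarith [hF0 N]
    rw [div_le_iff₀ hX, hg_def]
    simp only [hm1]
    have : (Real.exp (K * t * Real.sqrt (Real.log ((N : ℝ) + 2))) * ((N : ℝ) + 1)⁻¹ +
        t * (Real.exp (K * t * Real.sqrt (Real.log ((N : ℝ) + 2))) * ((N : ℝ) + 1) ^ (-a))) * ((N : ℝ) + 1) =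
        Real.exp (K * t * Real.sqrt (Real.log ((N : ℝ) + 2))) *
          (1 + t * (((N : ℝ) + 1) * ((N : ℝ) + 1) ^ (-a))) := by
      field_simp
    rw [this]
    exact hle
  -- conclude in `ℝ≥0∞`
  have hlim : Tendsto (fun N : ℕ => ENNReal.ofReal (g N)) atTop (𝓝 0) := by
    simpa using ENNReal.tendsto_ofReal hg
  refine tendsto_of_tendsto_of_tendsto_of_le_of_le' tendsto_const_nhds hlim
    (Eventually.of_forall fun _ => zero_le) ?_
  filter_upwards [hbound] with N hN
  have hX : (0 : ℝ) < (N : ℝ) + 1 := by positivity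
  have hkl : klDiv ((Φ N).lawAt (cappedLaw σ a₀ θ₀ u₀ t C N (Φ N)) t)
      (localGibbsLaw σ (thermoActivity σ (ρ t)) (u t) (θ t) N (Φ N)) = ENNReal.ofReal (F N t) := by
    rw [hF_def, ENNReal.ofReal_toReal (hfin N)]
  have hN1 : ((N : ENNReal) + 1) = ENNReal.ofReal ((N : ℝ) + 1) := by
    rw [ENNReal.ofReal_add (Nat.cast_nonneg N) zero_le_one, ENNReal.ofReal_natCast, ENNReal.ofReal_one]
  rw [hkl, hN1, ← ENNReal.ofReal_div_of_pos hX]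
  exact ENNReal.ofReal_le_ofReal hN

/-- **`CappedEulerLimit` from the MESOSCOPIC capped window entropy step (conditional closure of crux
stmt-AtomisticToContinuum-17739, re-typed residue).** Statics (`stub_reference`) ∘ time zero (`stub_timeZero`) ∘ capped chain
Gronwall (`cappedEntropyPropagation_of_windowStepMeso`) ∘ entropy inequality for the capped laws (`tendstoHydroFieldsAt_of_klDiv_lawAt`),
exactly as `CappedEulerLimit_of_cappedWindowStep` (part II). The hypothesis is the registered residual stub
`stub_cappedWindowStepMeso` of line `registered` (v3) BY ITS STATEMENT. [cite: Yau1991, §2] [cite: NachtergaeleYau2003, §7.2] -/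
theorem CappedEulerLimit_of_cappedWindowStepMeso (hW : ∃ ηw : ℝ, 0 < ηw ∧ CappedWindowEntropyStepMesoBelow ηw) :
    Summit.AtomisticToContinuum.HydrodynamicLimit.Theses.SpeedCapSurgery.CappedEulerLimit := by
  obtain ⟨ηs, hηs, HR⟩ := stub_reference
  obtain ⟨ηd, hηd, HG⟩ := cappedEntropyPropagation_of_windowStepMeso hW
  refine ⟨min ηs ηd, lt_min hηs hηd, fun a₀ θ₀ u₀ ha hθ hu ha0 hθ0 => ?_⟩
  obtain ⟨σ₁, hσ₁, H₁⟩ := HR a₀ θ₀ u₀ ha hθ hu ha0 hθ0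
  obtain ⟨σ₂, hσ₂, H₂⟩ := stub_timeZero a₀ θ₀ u₀ ha hθ hu ha0 hθ0
  obtain ⟨σ₃, hσ₃, H₃⟩ := HG a₀ θ₀ u₀ ha hθ hu ha0 hθ0
  refine ⟨min σ₁ (min σ₂ σ₃), lt_min hσ₁ (lt_min hσ₂ hσ₃), ?_⟩
  intro σ hσ hσlt T ρ θ u hsol hguard Φ h0 t ht C
  have hσ₁' : σ < σ₁ := hσlt.trans_le (min_le_left _ _)
  have hσ₂' : σ < σ₂ := hσlt.trans_le ((min_le_right _ _).trans (min_le_left _ _))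
  have hσ₃' : σ < σ₃ := hσlt.trans_le ((min_le_right _ _).trans (min_le_right _ _))
  have hgs : ∀ s ∈ Ico 0 T, ∀ x, ρ s x * σ ^ 3 < ηs :=
    fun s hs x => (hguard s hs x).trans_le (min_le_left _ _)
  have hgd : ∀ s ∈ Ico 0 T, ∀ x, ρ s x * σ ^ 3 < ηd :=
    fun s hs x => (hguard s hs x).trans_le (min_le_right _ _)
  have hT : 0 < T := ht.1.trans_lt ht.2
  obtain ⟨hprob, href⟩ := H₁ σ hσ hσ₁' T ρ θ u hsol hgs Φ
  have hfam : ∀ s ∈ Ico 0 T, RefConcentrates σ (ρ s) (θ s) (u s) Φ := href h0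
  have hzero := H₂ σ hσ hσ₂' T ρ θ u hsol hT Φ h0
  have hkl := H₃ σ hσ hσ₃' T ρ θ u hsol hgd Φ hprob h0 hzero hfam t ht C
  obtain ⟨hψ, hconc⟩ := hfam t ht
  have hfinP : ∀ N, IsFiniteMeasure (cappedLaw σ a₀ θ₀ u₀ t C N (Φ N)) := fun N => by
    unfold cappedLaw
    infer_instance
  exact tendstoHydroFieldsAt_of_klDiv_lawAt (a := thermoActivity σ (ρ t)) Φ
    (fun N => cappedLaw σ a₀ θ₀ u₀ t C N (Φ N)) hconc hkl

end Summit.AtomisticToContinuum.HydrodynamicLimit.Theorems.CappedEulerLimit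

end
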